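import Literature.MathematicalPhysics.QuantumFieldTheory.Balaban1983to89.B6RandomWalkL2Schur
import Literature.MathematicalPhysics.QuantumFieldTheory.Balaban1983to89.B6Dg288ChartV1
import Literature.MathematicalPhysics.QuantumFieldTheory.Balaban1983to89.B6QGQTestBumpsKLevelV1
import HarnessLib

/-!
# `Balaban1983to89.B6QFormDgL2KLevelV1` — T. Bałaban, *Propagators and renormalization transformations for lattice gauge theories. II*,
Commun. Math. Phys. **96** (1984) 223–250 [Balaban1984PropagatorsII]: two `ℓ²` INPUTS of the interior-energy route to Prop. 2.6 (2.140)₄ at k levels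
(cell pub-ymgap, seat dag-p1, `HOME/pub-ymgap-dag-p1/HL3-PLAN.md`, file F2; census slot hl3 of `B6Prop26PrintedStage2KLevelV1.prop26Printed_kLevel_of_slots5`)
on the genuine k-level V1 torus family:

* §1 **THE `ℓ²` SIZE OF THE AVERAGING `Q` AND OF THE FORM `⟨QB, aQA⟩`** ((2.20) p. 226, (2.16) p. 225): `(Qv)_i = Σ_f q_i(f)v(f)` with `Σ_f q_i(f) = 1`,
  `0 ≤ q_i ≤ L^{−j(i)(d+1)}` (r03's `B6Ineq2142KLevelV1.qwt_le`), hence `(Qv)_i² ≤ Σ_f q_i(f)v(f)² ≤ L^{−j(i)(d+1)}Σ_{f : q_i(f)≠0} v(f)²` (Jensen; the pairing formula `(Qv)_i = Σ_f q_i(f)v(f)` is r03's `B6QGQTestBumpsKLevelV1.QE_apply_eq_sum_qwt`) and, with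
  the weights in the band (2.16) (`GlobalBand`: `w_i ≤ b₁(L^{j})^{d+1}(c_f/L^{j})²`), **`abs_inner_QaQ_le`**:
  `|⟨QB, aQA⟩| ≤ b₁ Σ_{i : (QB)_i ≠ 0} (c_f/L^{j(i)})² Σ_{f : q_i(f) ≠ 0} A(f)²` whenever `|B| ≤ |A|` pointwise — each index bond costs the SQUARED INVERSE
  LENGTH `ℓ_i^{−2} = (c_f/L^{j(i)})²` times the `ℓ²` mass of `A` on its straight contours, no volume factor.
* §2 **THE BLOCK-`ℓ²` MAJORANT OF `∂P∂* = ∂(1 − R)∂*` AT k LEVELS** ((2.88) p. 238): from p21's torus (2.88) read in the V1 model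
  (`B6Dg288ChartV1.hasMajorant_Dg_V1`, sup majorant `c_f²(d+1)C·(L^j)^{−2}e^{−δ₂d_T}`), the symmetry of `∂(1−R)∂*` and the Schur test
  (`B6RandomWalkL2Schur.hasL2Majorant_of_hasMajorant_symm`): **`hasL2Majorant_Dg_V1`** —
  `‖Δ(y)·∂P∂*u‖ ≤ c_f²(d+1)C·(L^{j(y)}L^{j(y′)})^{−1}·e^{−δ₂d_T(y,y′)}‖u‖` for `supp u ⊂ Δ(y′)`.

HONEST FRAMING (programme rule): statement-level skeleton of published theorems with citation tags; proofs where landed; nothing here is a claim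
about the Yang–Mills mass gap.  Bookkeeping over landed theorems (cited by name); the (2.88) estimate itself is p21's; nothing continuum ∕ mass-gap ∕ Clay.
THEOREMS ONLY, no `def`.  Seat `pub-ymgap-dag-p1` (prover), 2026-08-25.
-/

open scoped InnerProductSpace BigOperators

namespace Literature.MathematicalPhysics.QuantumFieldTheory.Balaban1983to89.B6QFormDgL2KLevelV1

open LatticeFieldCalculus B6SectADomainsV1 B6SectAOperatorsV1 B6SectAVectorModelV1
open BalabanImbrieJaffe1984to88.BIJ85AxialPropagator411 (BondSpace)
open B6MultiLevelBoxOperator (N0)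
open B6MultiLevelTorusOperator (TDomains)
open B6GlobalChartV1 (PV domT blkV1)
open B6Geom246MultiLevelTorus (geomT)
open B6Ineq2142KLevelV1 (lvl β qwt qwt_eq_sum qwt_le qwt_nonneg QE_apply_eq_sum cQ cQ_pos cQ_mul_card)
open B6CubeWindowV1 (GlobalBand)
open B6RandomWalk (HasMajorant)
open B6RandomWalkL2 (HasL2Majorant hasL2Majorant_mono)
open B6RandomWalkL2Schur (hasL2Majorant_of_hasMajorant_symm)
open B6OpTransposeV1 (tr tr_onFun_of_symm)
open B6Ineq2133TwoScaleV1 (onFun)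
open B6OpTransposeV1 (tr_apply_single)
open B5Eq118OneStroke (iterBlock card_iterBlock)
open B6QGQTestBumpsKLevelV1 (QE_apply_eq_sum_qwt)
open B6Dg288ChartV1 (hasMajorant_Dg_V1)
open B8Ineq192MultiLevelTorus (symmT)

noncomputable section

variable {d ℓ m K : ℕ} {hd : 1 ≤ d + 1} {hL : Odd (ℓ + 1) ∧ 1 < ℓ + 1} {Mh k R : ℕ} {P' : Fin (d + 1) → ℕ}

/-! ## §1  The `ℓ²` size of `Q` and of the form `⟨QB, aQA⟩` -/

section QForm

variable (hN : ∀ μ, N0 ℓ Mh k P' μ = (PV d ℓ m K hd hL).sitesPerDir 0) (D : TDomains d ℓ Mh k P' R) (hk : k ≤ m + K)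

/-- **`Σ_f q_i(f) = 1`** (the averaging is a convex combination: `L^{−j(D+1)}` pairs `(x, t)`, `#B^j(y)·L^j` of them).
[cite: Balaban1984PropagatorsI, (1.18) p.20] -/
theorem sum_qwt_eq_one (i : BondIdx (domT hN D hk)) : ∑ f, qwt hN D hk i f = 1 := by
  classical
  have h := QE_apply_eq_sum_qwt hN D hk i (WithLp.toLp 2 fun _ => (1 : ℝ))
  simp only [mul_one] at h
  rw [← h, QE_apply_eq_sum]
  simp only [Finset.sum_const, Finset.card_range, nsmul_eq_mul, mul_one]
  rw [card_iterBlock _ (B6Ineq2142KLevelV1.lvl_le_mK hN D hk i) _]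
  have := cQ_mul_card (d := d) (ℓ := ℓ) (lvl hN D hk i)
  push_cast at this ⊢
  simpa [PV, mul_comm, mul_assoc, mul_left_comm] using this

/-- **JENSEN FOR THE AVERAGE**: `(Qv)_i² ≤ Σ_f q_i(f)·v(f)²` (`q_i ≥ 0`, `Σ_f q_i = 1`). [cite: Balaban1984PropagatorsI, (1.18) p.20; folklore (Jensen)] -/
theorem sq_QE_apply_le (i : BondIdx (domT hN D hk)) (v : BondSpace (PV d ℓ m K hd hL)) :
    QE (domT hN D hk) v i ^ 2 ≤ ∑ f, qwt hN D hk i f * v f ^ 2 := by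
  rw [QE_apply_eq_sum_qwt]
  have hq := fun f => qwt_nonneg hN D hk i f
  -- Cauchy–Schwarz with `√q_f` and `√q_f·v_f`
  have hcs := Finset.sum_mul_sq_le_sq_mul_sq Finset.univ (fun f => Real.sqrt (qwt hN D hk i f))
    (fun f => Real.sqrt (qwt hN D hk i f) * v f)
  have e1 : ∀ f, Real.sqrt (qwt hN D hk i f) * (Real.sqrt (qwt hN D hk i f) * v f) = qwt hN D hk i f * v f := fun f => by
    rw [← mul_assoc, Real.mul_self_sqrt (hq f)]
  have e2 : ∀ f, Real.sqrt (qwt hN D hk i f) ^ 2 = qwt hN D hk i f := fun f => Real.sq_sqrt (hq f)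
  have e3 : ∀ f, (Real.sqrt (qwt hN D hk i f) * v f) ^ 2 = qwt hN D hk i f * v f ^ 2 := fun f => by
    rw [mul_pow, Real.sq_sqrt (hq f)]
  simp only [e1, e2, e3, sum_qwt_eq_one, one_mul] at hcs
  exact hcs

/-- **THE `ℓ²` SIZE OF ONE AVERAGE**: `(Qv)_i² ≤ L^{−j(i)(d+1)}·Σ_{f : q_i(f) ≠ 0} v(f)²` (`q_i ≤ L^{−j(D+1)}`, `B6Ineq2142KLevelV1.qwt_le`).
[cite: Balaban1984PropagatorsI, (1.18) p.20; Balaban1984PropagatorsII, (2.20) p.226] -/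
theorem sq_QE_apply_le_supp (i : BondIdx (domT hN D hk)) (v : BondSpace (PV d ℓ m K hd hL)) :
    QE (domT hN D hk) v i ^ 2 ≤ ((((ℓ + 1 : ℕ) : ℝ) ^ (d + 1)) ^ (lvl hN D hk i))⁻¹ *
      ∑ f, (if qwt hN D hk i f = 0 then 0 else v f ^ 2) := by
  classical
  refine (sq_QE_apply_le hN D hk i v).trans ?_
  rw [Finset.mul_sum]
  refine Finset.sum_le_sum fun f _ => ?_
  split_ifs with h
  · rw [h, zero_mul, mul_zero]
  · exact mul_le_mul_of_nonneg_right (qwt_le hN D hk i f) (sq_nonneg _)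

/-- the band (2.16) as an upper bound on a weight: `w_i·L^{−j(i)(d+1)} ≤ b₁·(c_f/L^{j(i)})²`. [cite: Balaban1984PropagatorsII, (2.16) p.225] -/
theorem weight_mul_inv_le {b₀ b₁ cf : ℝ} {w : BondIdx (domT hN D hk) → ℝ} (hwb : GlobalBand b₀ b₁ cf w) (hcf : cf ≠ 0)
    (i : BondIdx (domT hN D hk)) :
    w i * ((((ℓ + 1 : ℕ) : ℝ) ^ (d + 1)) ^ (lvl hN D hk i))⁻¹ ≤ b₁ * (cf / (((ℓ + 1 : ℕ) : ℝ)) ^ (lvl hN D hk i)) ^ 2 := by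
  have h := (hwb i).2
  have hL0 : (0 : ℝ) < (((ℓ + 1 : ℕ) : ℝ)) ^ (lvl hN D hk i) := by positivity
  have hq : (0 : ℝ) < (cf / (((ℓ + 1 : ℕ) : ℝ)) ^ (lvl hN D hk i)) ^ 2 := by
    have : cf / (((ℓ + 1 : ℕ) : ℝ)) ^ (lvl hN D hk i) ≠ 0 := div_ne_zero hcf hL0.ne'
    positivity
  rw [div_le_iff₀ hq] at h
  have hpow : ((((ℓ + 1 : ℕ) : ℝ)) ^ (lvl hN D hk i)) ^ (d + 1) = ((((ℓ + 1 : ℕ) : ℝ) ^ (d + 1)) ^ (lvl hN D hk i)) := by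
    rw [← pow_mul, ← pow_mul, mul_comm]
  have hP0 : (0 : ℝ) < ((((ℓ + 1 : ℕ) : ℝ) ^ (d + 1)) ^ (lvl hN D hk i)) := by positivity
  rw [show (lvl hN D hk i) = (i.1.1 : ℕ) from rfl] at *
  rw [hpow] at h
  calc w i * ((((ℓ + 1 : ℕ) : ℝ) ^ (d + 1)) ^ (i.1.1 : ℕ))⁻¹
      ≤ (b₁ * ((((ℓ + 1 : ℕ) : ℝ) ^ (d + 1)) ^ (i.1.1 : ℕ)) * (cf / (((ℓ + 1 : ℕ) : ℝ)) ^ (i.1.1 : ℕ)) ^ 2) *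
          ((((ℓ + 1 : ℕ) : ℝ) ^ (d + 1)) ^ (i.1.1 : ℕ))⁻¹ := mul_le_mul_of_nonneg_right h (inv_nonneg.2 hP0.le)
    _ = b₁ * (cf / (((ℓ + 1 : ℕ) : ℝ)) ^ (i.1.1 : ℕ)) ^ 2 := by field_simp

/-- **THE `ℓ²` BOUND OF THE FORM `⟨QB, aQA⟩`** for fields with `|B| ≤ |A|` pointwise (e.g. `B = χ²A`, `0 ≤ χ ≤ 1`) and weights in the band (2.16):
`|⟨QB, aQA⟩| ≤ b₁·Σ_{i : (QB)_i ≠ 0} (c_f/L^{j(i)})²·Σ_{f : q_i(f) ≠ 0} A(f)²` — the squared inverse length of each index bond whose contours meet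
`supp B`, times the `ℓ²` mass of `A` on those contours. [cite: Balaban1984PropagatorsII, (2.16) p.225, (2.19)–(2.20) p.226] -/
theorem abs_inner_QaQ_le {b₀ b₁ cf : ℝ} {w : BondIdx (domT hN D hk) → ℝ} (hwb : GlobalBand b₀ b₁ cf w) (hcf : cf ≠ 0)
    (hw : ∀ i, 0 ≤ w i) (A B : BondSpace (PV d ℓ m K hd hL)) (hBA : ∀ f, |B f| ≤ |A f|) :
    |⟪QE (domT hN D hk) B, aE (domT hN D hk) w (QE (domT hN D hk) A)⟫_ℝ| ≤
      b₁ * ∑ i, (if QE (domT hN D hk) B i = 0 then 0 else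
        (cf / (((ℓ + 1 : ℕ) : ℝ)) ^ (lvl hN D hk i)) ^ 2 * ∑ f, (if qwt hN D hk i f = 0 then 0 else A f ^ 2)) := by
  classical
  rw [inner_eq_sum, Finset.mul_sum]
  refine (Finset.abs_sum_le_sum_abs _ _).trans (Finset.sum_le_sum fun i _ => ?_)
  rw [aE_apply]
  split_ifs with h0
  · rw [h0, zero_mul, abs_zero, mul_zero]
  · -- `|QB_i · w_i · QA_i| ≤ w_i·½(QB_i² + QA_i²) ≤ w_i·Σ_f q_i(f)A(f)² ≤ …`
    have hq := fun f => qwt_nonneg hN D hk i f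
    have hBsq : ∑ f, qwt hN D hk i f * B f ^ 2 ≤ ∑ f, qwt hN D hk i f * A f ^ 2 :=
      Finset.sum_le_sum fun f _ => mul_le_mul_of_nonneg_left (by
        have h := pow_le_pow_left₀ (abs_nonneg _) (hBA f) 2
        rwa [sq_abs, sq_abs] at h) (hq f)
    have h1 : |QE (domT hN D hk) B i * (w i * QE (domT hN D hk) A i)| ≤
        w i * ((QE (domT hN D hk) B i ^ 2 + QE (domT hN D hk) A i ^ 2) / 2) := by
      rw [show QE (domT hN D hk) B i * (w i * QE (domT hN D hk) A i) = w i * (QE (domT hN D hk) B i * QE (domT hN D hk) A i) by ring,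
        abs_mul, abs_of_nonneg (hw i)]
      refine mul_le_mul_of_nonneg_left ?_ (hw i)
      rw [abs_mul]
      nlinarith [sq_abs (QE (domT hN D hk) B i), sq_abs (QE (domT hN D hk) A i),
        sq_nonneg (|QE (domT hN D hk) B i| - |QE (domT hN D hk) A i|)]
    have h2 : (QE (domT hN D hk) B i ^ 2 + QE (domT hN D hk) A i ^ 2) / 2 ≤
        ((((ℓ + 1 : ℕ) : ℝ) ^ (d + 1)) ^ (lvl hN D hk i))⁻¹ * ∑ f, (if qwt hN D hk i f = 0 then 0 else A f ^ 2) := by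
      have hA := sq_QE_apply_le_supp hN D hk i A
      have hB := (sq_QE_apply_le hN D hk i B).trans hBsq
      have hB' : QE (domT hN D hk) B i ^ 2 ≤ ((((ℓ + 1 : ℕ) : ℝ) ^ (d + 1)) ^ (lvl hN D hk i))⁻¹ *
          ∑ f, (if qwt hN D hk i f = 0 then 0 else A f ^ 2) := by
        refine hB.trans ?_
        rw [Finset.mul_sum]
        refine Finset.sum_le_sum fun f _ => ?_
        split_ifs with h
        · rw [h, zero_mul, mul_zero]
        · exact mul_le_mul_of_nonneg_right (qwt_le hN D hk i f) (sq_nonneg _)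
      linarith
    calc |QE (domT hN D hk) B i * (w i * QE (domT hN D hk) A i)|
        ≤ w i * ((QE (domT hN D hk) B i ^ 2 + QE (domT hN D hk) A i ^ 2) / 2) := h1
      _ ≤ w i * (((((ℓ + 1 : ℕ) : ℝ) ^ (d + 1)) ^ (lvl hN D hk i))⁻¹ * ∑ f, (if qwt hN D hk i f = 0 then 0 else A f ^ 2)) :=
          mul_le_mul_of_nonneg_left h2 (hw i)
      _ = (w i * ((((ℓ + 1 : ℕ) : ℝ) ^ (d + 1)) ^ (lvl hN D hk i))⁻¹) * ∑ f, (if qwt hN D hk i f = 0 then 0 else A f ^ 2) := by ring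
      _ ≤ (b₁ * (cf / (((ℓ + 1 : ℕ) : ℝ)) ^ (lvl hN D hk i)) ^ 2) * ∑ f, (if qwt hN D hk i f = 0 then 0 else A f ^ 2) :=
          mul_le_mul_of_nonneg_right (weight_mul_inv_le hN D hk hwb hcf i)
            (Finset.sum_nonneg fun f _ => by split_ifs <;> positivity)
      _ = b₁ * ((cf / (((ℓ + 1 : ℕ) : ℝ)) ^ (lvl hN D hk i)) ^ 2 * ∑ f, (if qwt hN D hk i f = 0 then 0 else A f ^ 2)) := by ring

end QForm

/-! ## §2  The block-`ℓ²` majorant of `∂P∂*` at k levels -/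

/-- `∂(1 − R)∂*` is symmetric on `L²` (`∂*` is the adjoint of `∂`, `R` an orthogonal projection). [cite: Balaban1984PropagatorsII, (2.10)–(2.12) p.225, (2.19) p.226] -/
theorem inner_Dg_symm {P : Params} (Dm : Domains P) (c : ℝ) (u v : BondSpace P) :
    ⟪(dE c ∘ₗ (LinearMap.id - RE Dm c) ∘ₗ dsE c) u, v⟫_ℝ = ⟪u, (dE c ∘ₗ (LinearMap.id - RE Dm c) ∘ₗ dsE c) v⟫_ℝ := by
  simp only [LinearMap.coe_comp, Function.comp_apply, LinearMap.sub_apply, LinearMap.id_apply]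
  rw [inner_dE_left, ← inner_dsE_left, inner_sub_left, inner_sub_right, inner_RE_left]

/-- **THE BLOCK-`ℓ²` MAJORANT OF `∂P∂* = ∂(1 − R)∂*` ON THE GENUINE k-LEVEL V1 TORUS FAMILY**: `∃ M₃ δ₂ > 0, C > 0` (on `d, L`) such that for
`L·M_h ≥ M₃`, `R ≥ 2L`, `P_μ ≥ 4`, every `D`, every `c ≠ 0`: `‖Δ(y)·∂(1−R)∂*u‖ ≤ c²(d+1)C·(L^{j(y)}L^{j(y′)})^{−1}·e^{−δ₂d_T(y,y′)}·‖u‖` for `supp u ⊂ Δ(y′)`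
— the Schur test on the symmetric operator with p21's (2.88) sup majorant (`B6Dg288ChartV1.hasMajorant_Dg_V1`).
[cite: Balaban1984PropagatorsII, (2.88) p.238, (2.140)–(2.141) p.247 (the ℓ² norms)] -/
theorem hasL2Majorant_Dg_V1 (d ℓ : ℕ) (hd : 1 ≤ d + 1) (hL : Odd (ℓ + 1) ∧ 1 < ℓ + 1) :
    ∃ M₃ δ₂ C : ℝ, 0 < M₃ ∧ 0 < δ₂ ∧ 0 < C ∧
      ∀ (m K : ℕ) {Mh k R : ℕ} {P' : Fin (d + 1) → ℕ} (hN : ∀ μ, N0 ℓ Mh k P' μ = (PV d ℓ m K hd hL).sitesPerDir 0)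
        (D : TDomains d ℓ Mh k P' R) (hk : k ≤ m + K), 1 ≤ Mh → (∀ μ, 4 ≤ P' μ) → 2 * (ℓ + 1) ≤ R → M₃ ≤ ((ℓ : ℝ) + 1) * Mh →
        ∀ {c : ℝ}, c ≠ 0 →
          HasL2Majorant (g := geomT D) (blkV1 hN D) (onFun (dE c ∘ₗ (LinearMap.id - RE (domT hN D hk) c) ∘ₗ dsE c))
            (fun y y' => c ^ 2 * ((d : ℝ) + 1) * C / ((geomT D).len y * (geomT D).len y') *
              Real.exp (-(δ₂ * (geomT D).dist y y'))) := by
  classical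
  obtain ⟨M₃, δ₂, C, hM₃, hδ₂, hC, h⟩ := hasMajorant_Dg_V1 d ℓ hd hL
  refine ⟨M₃, δ₂, C, hM₃, hδ₂, hC, fun m K Mh k R P' hN D hk hMh hP4 hR hM c hc => ?_⟩
  have hT := h m K hN D hk hMh hP4 hR hM hc
  have hlen : ∀ y : (geomT D).Site, 0 < (geomT D).len y := fun y => by
    show 0 < ((ℓ : ℝ) + 1) ^ y.1.1 * 1; positivity
  have hK0 : ∀ y y' : (geomT D).Site,
      0 ≤ c ^ 2 * ((d : ℝ) + 1) * C / (geomT D).len y ^ 2 * Real.exp (-(δ₂ * (geomT D).dist y y')) := fun y y' => by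
    have := hlen y; positivity
  have hsymm : ∀ x x' : PBond (PV d ℓ m K hd hL) 0,
      (onFun (dE c ∘ₗ (LinearMap.id - RE (domT hN D hk) c) ∘ₗ dsE c)) (Pi.single x 1) x' =
        (onFun (dE c ∘ₗ (LinearMap.id - RE (domT hN D hk) c) ∘ₗ dsE c)) (Pi.single x' 1) x := by
    intro x x'
    have htr := tr_apply_single (onFun (dE c ∘ₗ (LinearMap.id - RE (domT hN D hk) c) ∘ₗ dsE c)) (Pi.single x 1) x'
    rw [tr_onFun_of_symm (inner_Dg_symm (domT hN D hk) c)] at htr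
    rw [htr]
    simp [dotProduct, Pi.single_apply]
  refine hasL2Majorant_mono (g := geomT D) (blkV1 hN D) (hasL2Majorant_of_hasMajorant_symm (g := geomT D) (blkV1 hN D) hT hK0 hsymm)
    fun y y' => le_of_eq ?_
  rw [symmT D y' y]
  have hy := hlen y
  have hy' := hlen y'
  have hprod : c ^ 2 * ((d : ℝ) + 1) * C / (geomT D).len y ^ 2 * Real.exp (-(δ₂ * (geomT D).dist y y')) *
      (c ^ 2 * ((d : ℝ) + 1) * C / (geomT D).len y' ^ 2 * Real.exp (-(δ₂ * (geomT D).dist y y'))) =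
      (c ^ 2 * ((d : ℝ) + 1) * C / ((geomT D).len y * (geomT D).len y') * Real.exp (-(δ₂ * (geomT D).dist y y'))) ^ 2 := by
    field_simp
  rw [hprod, Real.sqrt_sq (by positivity)]

end

end Literature.MathematicalPhysics.QuantumFieldTheory.Balaban1983to89.B6QFormDgL2KLevelV1
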